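import Mathlib.Analysis.Calculus.ContDiff.Bounds
import Mathlib.Analysis.Normed.Module.FiniteDimension
import Mathlib.Topology.MetricSpace.ProperSpace
import Literature.Geometry.Riemannian.TimeJetGluing
import HarnessLib

/-!
# Bounds on all space–time derivatives of a solution of an evolution equation from bounds on
# its spatial derivatives (topic `Analysis/Calculus`; pure calculus on `E × ℝ`)

Analysis/Calculus support file (everything proved; no definitions, no named facts), the
quantitative companion of `Literature/Geometry/Riemannian/TimeJetGluing.lean` (P. Topping,
*Lectures on the Ricci flow*, 2006, proof of Thm. 5.3.1, p. 47: to extend a flow smoothly to the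
final time "we will have achieved this if we can show that … all space-time derivatives of `g_{ij}`
are bounded", and "`∂ᵏg/∂tᵏ` [is written] in terms of the curvature and its spacial derivatives" by
differentiating the equation). In every continuation argument for a smooth solution `u` of an
evolution equation `∂ₜu = Θ(u, ∂_y u, ∂_y² u)` on `V × [a, T)` one proves A PRIORI bounds on the
SPATIAL derivatives of `u` only (energy estimates, maximum principles); the bounds on the mixed and
pure time derivatives, needed to extend `u` smoothly to `V × [a, T]`
(`Literature.Analysis.Calculus.exists_contDiffOn_closure_of_bounded_iteratedFDeriv`,
`SmoothExtensionToClosure.lean`), then follow from the equation. This file proves that implication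
once and for all, in the vocabulary `TimeJet.tD / xD / tDi` (time derivative within the time set,
space derivative of the slices, iterated time derivatives) of `TimeJetGluing.lean`:

* `TimeJetBounds.sliceBound_comp_left_zero` — sup bounds on all spatial derivatives of a composite
  `Θ ∘ g` from those of `g`, when `g` takes values in a compact subset of the open set on which `Θ`
  is smooth (Mathlib's `norm_iteratedFDerivWithin_comp_le`);
* `TimeJetBounds.sliceBound_tDi_comp_left` — the graded version: bounds on all spatial
  derivatives of `∂ₜʲ(Θ ∘ g)`, `j ≤ k`, from those of `∂ₜʲ g`, `j ≤ k` (induction on `k` through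
  `∂ₜ(Θ ∘ g) = DΘ(g)[∂ₜg]`, the mechanism of `TimeJet.JetEq.comp_left`);
* `TimeJetBounds.sliceBound_tDi_of_pde` — for a smooth solution of
  `∂ₜu = Θ(u, ∂_y u, ∂_y² u)` on `V × S` whose 2-jets over `V × S'` lie in a compact subset of the
  domain of `Θ`: bounds on all spatial derivatives of `u` over `V × S'` give bounds on all spatial
  derivatives of every `∂ₜᵏu` over `V × S'`;
* `TimeJetBounds.exists_norm_iteratedFDerivWithin_le` — bounds on all spatial derivatives of all
  `∂ₜᵏu` give bounds on all iterated (space–time) derivatives `Dⁿu` within `V × S`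
  (`Du = ∂_y u ∘ pr₁ + pr₂ · ∂ₜu`, induction on `n`, as in `TimeJet.iteratedFDerivWithin_eq_of_jetEq`);
* `TimeJetBounds.exists_norm_iteratedFDeriv_le_of_pde` — CONCLUSION: a smooth solution on `V × S`
  with bounded spatial derivatives of all orders over `V × S'` and 2-jets there in a compact part
  of the domain of `Θ` has all its space–time derivatives bounded over `V × S₀` for every open
  `S₀ ⊆ S'` — the hypothesis `hb` of `exists_contDiffOn_closure_of_bounded_iteratedFDeriv` /
  `exists_contDiffOn_slab_extension`.

All spaces are finite-dimensional where compactness of closed balls is used (the range of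
`(g, ∂ₜg)` must again be relatively compact). Slices `y ↦ g (y, t)` of a function smooth on
`V × S` are smooth on the open set `V`, so their derivatives are the unrestricted `iteratedFDeriv`.

## Mathlib / tree search

Mathlib: `norm_iteratedFDerivWithin_comp_le` (bounds for `Dⁿ(g ∘ f)`), `norm_iteratedFDeriv_fderiv`,
`norm_iteratedFDerivWithin_fderivWithin`, `iteratedFDeriv_prodMk`,
`ContinuousLinearMap.norm_iteratedFDeriv(Within)_comp_left`, `iteratedFDerivWithin_add_apply`,
`iteratedFDerivWithin_eq_iteratedFDeriv`, `IsCompact.exists_bound_of_continuousOn`. Tree: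
`TimeJet.*` (`TimeJetGluing.lean`: `tD_comp_left`, `tDi_xD_comm`, `tDi_prodMk`, `tDi_congr`,
`fderivWithin_eq_xD_add_tD`, `contDiffOn_tD/xD/tDi`); `JetTower.lean` (joint smoothness from the
equation, qualitative) and `SmoothExtensionToClosure.lean` (the consumer). Searched
`lean search 'iteratedFDeriv.*tDi|sliceBound|bounded_iteratedFDeriv.*pde'`: nothing quantitative.

## References

* P. Topping, *Lectures on the Ricci flow*, LMS Lecture Note Series 325, CUP 2006, §5.3, proof of
  Thm. 5.3.1, p. 47. [Topping2006]
* A. Majda, *Compressible Fluid Flow and Systems of Conservation Laws in Several Space Variables*,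
  Springer 1984, Ch. 2, proof of Thm. 2.2 ("`uₜ` is then bounded through the equations").
  [Majda1984]
-/

noncomputable section

open Set Filter Function Metric
open scoped Topology ContDiff

namespace Literature.Analysis.Calculus

namespace TimeJetBounds

open Literature.Geometry.Riemannian Literature.Geometry.Riemannian.TimeJet

universe u

variable {E : Type u} [NormedAddCommGroup E] [NormedSpace ℝ E]
  {F : Type u} [NormedAddCommGroup F] [NormedSpace ℝ F]
  {F' : Type u} [NormedAddCommGroup F'] [NormedSpace ℝ F']

/-! ### Slices and their derivatives -/

section Slices

variable {V : Set E} {S S' : Set ℝ} {g : E × ℝ → F} {t : ℝ} {y : E}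

/-- The slices `y ↦ g (y, t)`, `t ∈ S`, of a function `C^∞` on `V × S` are `C^∞` on `V`.
[folklore] -/
theorem contDiffOn_slice (hg : ContDiffOn ℝ ∞ g (V ×ˢ S)) (ht : t ∈ S) :
    ContDiffOn ℝ ∞ (fun y ↦ g (y, t)) V :=
  hg.comp (contDiff_id.prodMk contDiff_const).contDiffOn fun _ hy ↦ ⟨hy, ht⟩

/-- The slices of a function `C^∞` on `V × S` (`V` open) are `C^∞` at every point of `V`.
[folklore] -/
theorem contDiffAt_slice (hV : IsOpen V) (hg : ContDiffOn ℝ ∞ g (V ×ˢ S)) (ht : t ∈ S)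
    (hy : y ∈ V) : ContDiffAt ℝ ∞ (fun y ↦ g (y, t)) y :=
  (contDiffOn_slice hg ht).contDiffAt (hV.mem_nhds hy)

omit [NormedAddCommGroup F] [NormedSpace ℝ F] in
/-- The slice of `∂_y g` at time `t` is the Fréchet derivative of the slice of `g`. [folklore] -/
theorem slice_xD (g : E × ℝ → F') (t : ℝ) :
    (fun y ↦ xD g (y, t)) = fderiv ℝ (fun y ↦ g (y, t)) := rfl

/-- **Spatial derivatives of `∂_y g` are spatial derivatives of `g` of one order more**:
`‖D_yᵐ (∂_y g)(y, t)‖ = ‖D_yᵐ⁺¹ g (y, t)‖`. [folklore] -/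
theorem norm_iteratedFDeriv_slice_xD (g : E × ℝ → F) (m : ℕ) (y : E) (t : ℝ) :
    ‖iteratedFDeriv ℝ m (fun y ↦ xD g (y, t)) y‖ =
      ‖iteratedFDeriv ℝ (m + 1) (fun y ↦ g (y, t)) y‖ := by
  rw [slice_xD, norm_iteratedFDeriv_fderiv]

/-- Spatial derivatives of slices only depend on the values on `V × S` (`V` open). [folklore] -/
theorem iteratedFDeriv_slice_congr (hV : IsOpen V) {g' : E × ℝ → F} (h : EqOn g g' (V ×ˢ S))
    (ht : t ∈ S) (hy : y ∈ V) (m : ℕ) :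
    iteratedFDeriv ℝ m (fun y ↦ g (y, t)) y = iteratedFDeriv ℝ m (fun y ↦ g' (y, t)) y := by
  have hev : (fun y ↦ g (y, t)) =ᶠ[𝓝 y] fun y ↦ g' (y, t) :=
    Filter.eventually_of_mem (hV.mem_nhds hy) fun y' hy' ↦ h (show (y', t) ∈ V ×ˢ S from ⟨hy', ht⟩)
  exact (hev.iteratedFDeriv ℝ m).eq_of_nhds

/-- Spatial derivatives of a pair are bounded by the sum of those of the components. [folklore] -/
theorem norm_iteratedFDeriv_slice_prodMk_le (hV : IsOpen V) (hg : ContDiffOn ℝ ∞ g (V ×ˢ S))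
    {g₂ : E × ℝ → F'} (hg₂ : ContDiffOn ℝ ∞ g₂ (V ×ˢ S)) (ht : t ∈ S) (hy : y ∈ V) (m : ℕ) :
    ‖iteratedFDeriv ℝ m (fun y ↦ (g (y, t), g₂ (y, t))) y‖ ≤
      ‖iteratedFDeriv ℝ m (fun y ↦ g (y, t)) y‖ + ‖iteratedFDeriv ℝ m (fun y ↦ g₂ (y, t)) y‖ := by
  rw [iteratedFDeriv_prodMk ((contDiffAt_slice hV hg ht hy).of_le (by exact_mod_cast le_top))
    ((contDiffAt_slice hV hg₂ ht hy).of_le (by exact_mod_cast le_top)) (le_refl (m : WithTop ℕ∞)),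
    ContinuousMultilinearMap.opNorm_prod]
  exact max_le (le_add_of_nonneg_right (norm_nonneg _)) (le_add_of_nonneg_left (norm_nonneg _))

/-- Spatial derivatives of `L ∘ g`, `L` continuous linear, are bounded by `‖L‖` times those of
`g`. [folklore] -/
theorem norm_iteratedFDeriv_slice_clm_comp_le (hV : IsOpen V) (hg : ContDiffOn ℝ ∞ g (V ×ˢ S))
    (L : F →L[ℝ] F') (ht : t ∈ S) (hy : y ∈ V) (m : ℕ) :
    ‖iteratedFDeriv ℝ m (fun y ↦ L (g (y, t))) y‖ ≤ ‖L‖ * ‖iteratedFDeriv ℝ m (fun y ↦ g (y, t)) y‖ :=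
  L.norm_iteratedFDeriv_comp_left ((contDiffAt_slice hV hg ht hy).of_le (by exact_mod_cast le_top))
    (le_refl (m : WithTop ℕ∞))

end Slices

/-! ### Slice bounds: the currency -/

section Currency

variable {V : Set E} {S S' : Set ℝ}

/-- **Slice bounds for `∂_y g`** from slice bounds for `g` (one order more). [folklore] -/
theorem sliceBound_xD {g : E × ℝ → F}
    (h : ∀ m : ℕ, ∃ C : ℝ, ∀ q ∈ V ×ˢ S', ‖iteratedFDeriv ℝ m (fun y ↦ g (y, q.2)) q.1‖ ≤ C)
    (m : ℕ) : ∃ C : ℝ, ∀ q ∈ V ×ˢ S', ‖iteratedFDeriv ℝ m (fun y ↦ xD g (y, q.2)) q.1‖ ≤ C := by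
  obtain ⟨C, hC⟩ := h (m + 1)
  exact ⟨C, fun q hq ↦ by rw [norm_iteratedFDeriv_slice_xD]; exact hC q hq⟩

/-- **Slice bounds for all `∂ₜʲ ∂_y g`, `j ≤ k`,** from slice bounds for all `∂ₜʲ g`, `j ≤ k`
(`∂ₜʲ ∂_y = ∂_y ∂ₜʲ` on `V × S`, `TimeJet.tDi_xD_comm`). [folklore] -/
theorem sliceBound_tDi_xD (hV : IsOpen V) (hS : UniqueDiffOn ℝ S)
    (hS' : S ⊆ closure (interior S)) (hsub : S' ⊆ S) {g : E × ℝ → F}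
    (hg : ContDiffOn ℝ ∞ g (V ×ˢ S)) {k : ℕ}
    (h : ∀ j ≤ k, ∀ m : ℕ, ∃ C : ℝ, ∀ q ∈ V ×ˢ S',
      ‖iteratedFDeriv ℝ m (fun y ↦ tDi S j g (y, q.2)) q.1‖ ≤ C) :
    ∀ j ≤ k, ∀ m : ℕ, ∃ C : ℝ, ∀ q ∈ V ×ˢ S',
      ‖iteratedFDeriv ℝ m (fun y ↦ tDi S j (xD g) (y, q.2)) q.1‖ ≤ C := by
  intro j hj m
  obtain ⟨C, hC⟩ := h j hj (m + 1)
  refine ⟨C, fun q hq ↦ ?_⟩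
  rw [iteratedFDeriv_slice_congr hV (tDi_xD_comm hV hS hS' hg j) (hsub hq.2) hq.1 m,
    norm_iteratedFDeriv_slice_xD]
  exact hC q hq

/-- Slice bounds for a pair from slice bounds for the components. [folklore] -/
theorem sliceBound_prodMk (hV : IsOpen V) (hsub : S' ⊆ S) {g : E × ℝ → F} {g₂ : E × ℝ → F'}
    (hg : ContDiffOn ℝ ∞ g (V ×ˢ S)) (hg₂ : ContDiffOn ℝ ∞ g₂ (V ×ˢ S))
    (h : ∀ m : ℕ, ∃ C : ℝ, ∀ q ∈ V ×ˢ S', ‖iteratedFDeriv ℝ m (fun y ↦ g (y, q.2)) q.1‖ ≤ C)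
    (h₂ : ∀ m : ℕ, ∃ C : ℝ, ∀ q ∈ V ×ˢ S', ‖iteratedFDeriv ℝ m (fun y ↦ g₂ (y, q.2)) q.1‖ ≤ C)
    (m : ℕ) : ∃ C : ℝ, ∀ q ∈ V ×ˢ S',
      ‖iteratedFDeriv ℝ m (fun y ↦ (g (y, q.2), g₂ (y, q.2))) q.1‖ ≤ C := by
  obtain ⟨C, hC⟩ := h m
  obtain ⟨C₂, hC₂⟩ := h₂ m
  exact ⟨C + C₂, fun q hq ↦ (norm_iteratedFDeriv_slice_prodMk_le hV hg hg₂ (hsub hq.2) hq.1 m).trans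
    (add_le_add (hC q hq) (hC₂ q hq))⟩

/-- Slice bounds for all `∂ₜʲ` of a pair, `j ≤ k`, from those of the components. [folklore] -/
theorem sliceBound_tDi_prodMk (hV : IsOpen V) (hS : UniqueDiffOn ℝ S) (hsub : S' ⊆ S)
    {g : E × ℝ → F} {g₂ : E × ℝ → F'} (hg : ContDiffOn ℝ ∞ g (V ×ˢ S))
    (hg₂ : ContDiffOn ℝ ∞ g₂ (V ×ˢ S)) {k : ℕ}
    (h : ∀ j ≤ k, ∀ m : ℕ, ∃ C : ℝ, ∀ q ∈ V ×ˢ S',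
      ‖iteratedFDeriv ℝ m (fun y ↦ tDi S j g (y, q.2)) q.1‖ ≤ C)
    (h₂ : ∀ j ≤ k, ∀ m : ℕ, ∃ C : ℝ, ∀ q ∈ V ×ˢ S',
      ‖iteratedFDeriv ℝ m (fun y ↦ tDi S j g₂ (y, q.2)) q.1‖ ≤ C) :
    ∀ j ≤ k, ∀ m : ℕ, ∃ C : ℝ, ∀ q ∈ V ×ˢ S',
      ‖iteratedFDeriv ℝ m (fun y ↦ tDi S j (fun q ↦ (g q, g₂ q)) (y, q.2)) q.1‖ ≤ C := by
  intro j hj m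
  obtain ⟨C, hC⟩ := sliceBound_prodMk hV hsub (contDiffOn_tDi hV hS hg j) (contDiffOn_tDi hV hS hg₂ j)
    (h j hj) (h₂ j hj) m
  refine ⟨C, fun q hq ↦ ?_⟩
  rw [iteratedFDeriv_slice_congr hV (tDi_prodMk hV hS hg hg₂ j) (hsub hq.2) hq.1 m]
  exact hC q hq

end Currency

/-! ### Composition with a smooth map: sup bounds of all orders -/

section CompLeft

variable {V : Set E} {S S' : Set ℝ}

/-- **Sup bounds on all spatial derivatives of a composite `Θ ∘ g`.** Let `Θ` be `C^∞` on an open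
set `O`, `g` be `C^∞` on `V × S` (`V` open) with values in `O`, and suppose that over `V × S'`
(`S' ⊆ S`) the values of `g` lie in a compact `K ⊆ O` and all spatial derivatives of `g` are
bounded. Then all spatial derivatives of `Θ ∘ g` are bounded over `V × S'` (the derivatives of
`Θ` are bounded on `K`; Mathlib's `norm_iteratedFDerivWithin_comp_le`). [folklore] -/
theorem sliceBound_comp_left_zero (hV : IsOpen V) (hsub : S' ⊆ S) {Θ : F → F'} {O : Set F}
    (hO : IsOpen O) (hΘ : ContDiffOn ℝ ∞ Θ O) {K : Set F} (hK : IsCompact K) (hKO : K ⊆ O)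
    {g : E × ℝ → F} (hg : ContDiffOn ℝ ∞ g (V ×ˢ S)) (hgO : MapsTo g (V ×ˢ S) O)
    (hgK : MapsTo g (V ×ˢ S') K)
    (h : ∀ m : ℕ, ∃ C : ℝ, ∀ q ∈ V ×ˢ S', ‖iteratedFDeriv ℝ m (fun y ↦ g (y, q.2)) q.1‖ ≤ C)
    (m : ℕ) : ∃ C : ℝ, ∀ q ∈ V ×ˢ S', ‖iteratedFDeriv ℝ m (fun y ↦ Θ (g (y, q.2))) q.1‖ ≤ C := by
  -- bounds for the derivatives of `Θ` on `K`
  have hΘb : ∀ i : ℕ, ∃ C : ℝ, ∀ z ∈ K, ‖iteratedFDerivWithin ℝ i Θ O z‖ ≤ C := fun i ↦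
    hK.exists_bound_of_continuousOn
      ((hΘ.continuousOn_iteratedFDerivWithin (m := i) (by exact_mod_cast le_top)
        hO.uniqueDiffOn).mono hKO)
  choose CΘ hCΘ using hΘb
  choose Cg hCg using h
  set C₁ : ℝ := ∑ i ∈ Finset.range (m + 1), |CΘ i| with hC₁
  set D : ℝ := max 1 (∑ i ∈ Finset.range (m + 1), |Cg i|) with hD
  have hD1 : 1 ≤ D := le_max_left _ _
  refine ⟨(m.factorial : ℝ) * C₁ * D ^ m, fun q hq ↦ ?_⟩
  have ht : q.2 ∈ S := hsub hq.2
  have hsl : ContDiffOn ℝ ∞ (fun y ↦ g (y, q.2)) V := contDiffOn_slice hg ht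
  have hmaps : MapsTo (fun y ↦ g (y, q.2)) V O := fun y hy ↦ hgO ⟨hy, ht⟩
  have key := norm_iteratedFDerivWithin_comp_le (𝕜 := ℝ) (n := m) (N := (m : WithTop ℕ∞))
    (x := q.1) (hΘ.of_le (by exact_mod_cast le_top)) (hsl.of_le (by exact_mod_cast le_top)) le_rfl
    hO.uniqueDiffOn hV.uniqueDiffOn hmaps hq.1 (C := C₁) (D := D) ?_ ?_
  · rw [iteratedFDerivWithin_of_isOpen m hV hq.1] at key
    exact key
  · intro i hi
    have hz : g (q.1, q.2) ∈ K := hgK ⟨hq.1, hq.2⟩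
    calc ‖iteratedFDerivWithin ℝ i Θ O (g (q.1, q.2))‖ ≤ CΘ i := hCΘ i _ hz
      _ ≤ |CΘ i| := le_abs_self _
      _ ≤ C₁ := by
          rw [hC₁]
          exact Finset.single_le_sum (f := fun i ↦ |CΘ i|) (fun i _ ↦ abs_nonneg _)
            (Finset.mem_range.2 (Nat.lt_succ_of_le hi))
  · intro i hi1 him
    rw [iteratedFDerivWithin_of_isOpen i hV hq.1]
    calc ‖iteratedFDeriv ℝ i (fun y ↦ g (y, q.2)) q.1‖ ≤ Cg i := hCg i q hq
      _ ≤ |Cg i| := le_abs_self _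
      _ ≤ ∑ i ∈ Finset.range (m + 1), |Cg i| :=
          Finset.single_le_sum (f := fun i ↦ |Cg i|) (fun i _ ↦ abs_nonneg _)
            (Finset.mem_range.2 (Nat.lt_succ_of_le him))
      _ ≤ D := le_max_right _ _
      _ ≤ D ^ i := le_self_pow₀ hD1 (by omega)

/-- **Graded chain rule, quantitative: bounds on all spatial derivatives of `∂ₜʲ(Θ ∘ g)`, `j ≤ k`,
from bounds on all spatial derivatives of `∂ₜʲ g`, `j ≤ k`.** Here `Θ` is `C^∞` on an open set
`O` of a finite-dimensional space, `g` is `C^∞` on `V × S` with values in `O`, and over `V × S'`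
its values lie in a compact `K ⊆ O`. Induction on `k`: `∂ₜ(Θ ∘ g) = Θ̃ ∘ (g, ∂ₜg)` with
`Θ̃(a, b) = DΘ(a) b` smooth on `O × F`, and over `V × S'` the pair `(g, ∂ₜg)` lies in the compact
`K × B̄(0, C)` (the mechanism of `TimeJet.JetEq.comp_left`; Topping 2006, p. 47).
[cite: Topping2006, §5.3, p. 47] -/
theorem sliceBound_tDi_comp_left (hV : IsOpen V) (hS : UniqueDiffOn ℝ S) (hsub : S' ⊆ S) :
    ∀ (k : ℕ) {F : Type u} [NormedAddCommGroup F] [NormedSpace ℝ F] [FiniteDimensional ℝ F]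
    {Θ : F → F'} {O : Set F} (_ : IsOpen O) (_ : ContDiffOn ℝ ∞ Θ O)
    {K : Set F} (_ : IsCompact K) (_ : K ⊆ O)
    {g : E × ℝ → F} (_ : ContDiffOn ℝ ∞ g (V ×ˢ S)) (_ : MapsTo g (V ×ˢ S) O)
    (_ : MapsTo g (V ×ˢ S') K)
    (_ : ∀ j ≤ k, ∀ m : ℕ, ∃ C : ℝ, ∀ q ∈ V ×ˢ S',
      ‖iteratedFDeriv ℝ m (fun y ↦ tDi S j g (y, q.2)) q.1‖ ≤ C),
    ∀ j ≤ k, ∀ m : ℕ, ∃ C : ℝ, ∀ q ∈ V ×ˢ S',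
      ‖iteratedFDeriv ℝ m (fun y ↦ tDi S j (fun q ↦ Θ (g q)) (y, q.2)) q.1‖ ≤ C := by
  intro k
  induction k with
  | zero =>
    intro F _ _ _ Θ O hO hΘ K hK hKO g hg hgO hgK h j hj m
    obtain rfl := Nat.le_zero.1 hj
    exact sliceBound_comp_left_zero hV hsub hO hΘ hK hKO hg hgO hgK (h 0 le_rfl) m
  | succ k ih =>
    intro F _ _ _ Θ O hO hΘ K hK hKO g hg hgO hgK h j hj m
    rcases j with _ | j
    · exact sliceBound_comp_left_zero hV hsub hO hΘ hK hKO hg hgO hgK (h 0 (Nat.zero_le _)) m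
    -- `∂ₜ^{j+1}(Θ ∘ g) = ∂ₜ^j (Θ̃ ∘ (g, ∂ₜg))`
    have hjk : j ≤ k := Nat.succ_le_succ_iff.1 hj
    have hΘ' : ContDiffOn ℝ ∞ (fun z : F × F ↦ fderiv ℝ Θ z.1 z.2) (O ×ˢ (univ : Set F)) :=
      ((hΘ.fderiv_of_isOpen hO (by simp)).comp contDiffOn_fst (fun z hz ↦ hz.1)).clm_apply
        contDiffOn_snd
    have hO' : IsOpen (O ×ˢ (univ : Set F)) := hO.prod isOpen_univ
    have hg' : ContDiffOn ℝ ∞ (fun q ↦ (g q, tD S g q)) (V ×ˢ S) := hg.prodMk (contDiffOn_tD hV hS hg)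
    have hgO' : MapsTo (fun q ↦ (g q, tD S g q)) (V ×ˢ S) (O ×ˢ (univ : Set F)) :=
      fun q hq ↦ ⟨hgO hq, mem_univ _⟩
    -- `∂ₜg` is bounded over `V × S'`
    obtain ⟨C₀, hC₀⟩ := h 1 (by omega) 0
    have hC₀' : ∀ q ∈ V ×ˢ S', ‖tD S g q‖ ≤ C₀ := by
      intro q hq
      have h1 := hC₀ q hq
      rw [norm_iteratedFDeriv_zero] at h1
      exact h1
    set K' : Set (F × F) := K ×ˢ closedBall (0 : F) C₀ with hK'
    have hK'c : IsCompact K' := hK.prod (isCompact_closedBall _ _)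
    have hK'O : K' ⊆ O ×ˢ (univ : Set F) := Set.prod_mono hKO (subset_univ _)
    have hgK' : MapsTo (fun q ↦ (g q, tD S g q)) (V ×ˢ S') K' := fun q hq ↦
      ⟨hgK hq, mem_closedBall_zero_iff.2 (hC₀' q hq)⟩
    -- slice bounds for `∂ₜ^j (g, ∂ₜ g)`, `j ≤ k`
    have hpair : ∀ j ≤ k, ∀ m : ℕ, ∃ C : ℝ, ∀ q ∈ V ×ˢ S',
        ‖iteratedFDeriv ℝ m (fun y ↦ tDi S j (fun q ↦ (g q, tD S g q)) (y, q.2)) q.1‖ ≤ C := by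
      refine sliceBound_tDi_prodMk hV hS hsub hg (contDiffOn_tD hV hS hg)
        (fun j hj ↦ h j (by omega)) (fun j hj m ↦ ?_)
      exact h (j + 1) (by omega) m
    obtain ⟨C, hC⟩ := ih hO' hΘ' hK'c hK'O hg' hgO' hgK' hpair j hjk m
    refine ⟨C, fun q hq ↦ ?_⟩
    -- identify `∂ₜ^{j+1}(Θ ∘ g)` with `∂ₜ^j(Θ̃ ∘ (g, ∂ₜ g))` on `V × S`
    have hcongr : EqOn (tDi S (j + 1) (fun q ↦ Θ (g q)))
        (tDi S j (fun q ↦ fderiv ℝ Θ (g q, tD S g q).1 (g q, tD S g q).2)) (V ×ˢ S) := by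
      rw [tDi_succ]
      exact tDi_congr (fun q hq ↦ tD_comp_left hS hg hO hΘ hgO hq) j
    rw [iteratedFDeriv_slice_congr hV hcongr (hsub hq.2) hq.1 m]
    exact hC q hq

end CompLeft

/-! ### From the equation: all spatial derivatives of all time derivatives -/

section PDE

variable {V : Set E} {S S' : Set ℝ} {u : E × ℝ → F}

/-- **A smooth solution of `∂ₜu = Θ(u, ∂_y u, ∂_y² u)` with bounded spatial derivatives has bounded
spatial derivatives of every time derivative.** Let `u` be `C^∞` on `V × S` (`V` open, `S` a time
set of unique differentiability with no point isolated from its interior) and satisfy there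
`∂ₜu = Θ(u, ∂_y u, ∂_y² u)` with `Θ` smooth on an open set `O` of the (finite-dimensional) jet
space containing the 2-jets of `u`; suppose that over `V × S'`, `S' ⊆ S`, the 2-jets of `u` lie in
a compact `K ⊆ O` and all spatial derivatives of `u` are bounded. Then, for every `k`, all spatial
derivatives of `∂ₜᵏu` are bounded over `V × S'` (induction on `k`: `∂ₜᵏ⁺¹u = ∂ₜᵏ Θ(Ju)` and the
graded chain rule `sliceBound_tDi_comp_left`; Majda 1984, proof of Thm. 2.2: "`uₜ` is bounded
through the equations"). [cite: Topping2006, §5.3, p. 47] -/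
theorem sliceBound_tDi_of_pde [FiniteDimensional ℝ E] [FiniteDimensional ℝ F] (hV : IsOpen V)
    (hS : UniqueDiffOn ℝ S) (hS' : S ⊆ closure (interior S)) (hsub : S' ⊆ S)
    {Θ : F × (E →L[ℝ] F) × (E →L[ℝ] E →L[ℝ] F) → F}
    {O : Set (F × (E →L[ℝ] F) × (E →L[ℝ] E →L[ℝ] F))} (hO : IsOpen O) (hΘ : ContDiffOn ℝ ∞ Θ O)
    {K : Set (F × (E →L[ℝ] F) × (E →L[ℝ] E →L[ℝ] F))} (hK : IsCompact K) (hKO : K ⊆ O)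
    (hu : ContDiffOn ℝ ∞ u (V ×ˢ S))
    (huO : MapsTo (fun q ↦ (u q, xD u q, xD (xD u) q)) (V ×ˢ S) O)
    (huK : MapsTo (fun q ↦ (u q, xD u q, xD (xD u) q)) (V ×ˢ S') K)
    (hpde : ∀ q ∈ V ×ˢ S, tD S u q = Θ (u q, xD u q, xD (xD u) q))
    (hb : ∀ m : ℕ, ∃ C : ℝ, ∀ q ∈ V ×ˢ S', ‖iteratedFDeriv ℝ m (fun y ↦ u (y, q.2)) q.1‖ ≤ C) :
    ∀ k m : ℕ, ∃ C : ℝ, ∀ q ∈ V ×ˢ S', ‖iteratedFDeriv ℝ m (fun y ↦ tDi S k u (y, q.2)) q.1‖ ≤ C := by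
  -- cumulative form
  suffices H : ∀ k, ∀ j ≤ k, ∀ m : ℕ, ∃ C : ℝ, ∀ q ∈ V ×ˢ S',
      ‖iteratedFDeriv ℝ m (fun y ↦ tDi S j u (y, q.2)) q.1‖ ≤ C from fun k m ↦ H k k le_rfl m
  intro k
  induction k with
  | zero =>
    intro j hj m
    obtain rfl := Nat.le_zero.1 hj
    exact hb m
  | succ k ih =>
    intro j hj m
    rcases j with _ | j
    · exact hb m
    have hjk : j ≤ k := Nat.succ_le_succ_iff.1 hj
    -- the jet map and its slice bounds up to time order `k`
    have hxD : ContDiffOn ℝ ∞ (xD u) (V ×ˢ S) := contDiffOn_xD hV hS hu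
    have hxD2 : ContDiffOn ℝ ∞ (xD (xD u)) (V ×ˢ S) := contDiffOn_xD hV hS hxD
    have hJ : ContDiffOn ℝ ∞ (fun q ↦ (u q, xD u q, xD (xD u) q)) (V ×ˢ S) :=
      hu.prodMk (hxD.prodMk hxD2)
    have hbxD : ∀ j ≤ k, ∀ m : ℕ, ∃ C : ℝ, ∀ q ∈ V ×ˢ S',
        ‖iteratedFDeriv ℝ m (fun y ↦ tDi S j (xD u) (y, q.2)) q.1‖ ≤ C :=
      sliceBound_tDi_xD hV hS hS' hsub hu ih
    have hbxD2 : ∀ j ≤ k, ∀ m : ℕ, ∃ C : ℝ, ∀ q ∈ V ×ˢ S',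
        ‖iteratedFDeriv ℝ m (fun y ↦ tDi S j (xD (xD u)) (y, q.2)) q.1‖ ≤ C :=
      sliceBound_tDi_xD hV hS hS' hsub hxD hbxD
    have hbJ : ∀ j ≤ k, ∀ m : ℕ, ∃ C : ℝ, ∀ q ∈ V ×ˢ S',
        ‖iteratedFDeriv ℝ m (fun y ↦ tDi S j (fun q ↦ (u q, xD u q, xD (xD u) q)) (y, q.2)) q.1‖ ≤ C :=
      sliceBound_tDi_prodMk hV hS hsub hu (hxD.prodMk hxD2) ih
        (sliceBound_tDi_prodMk hV hS hsub hxD hxD2 hbxD hbxD2)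
    obtain ⟨C, hC⟩ := sliceBound_tDi_comp_left hV hS hsub k hO hΘ hK hKO hJ huO huK hbJ j hjk m
    refine ⟨C, fun q hq ↦ ?_⟩
    have hcongr : EqOn (tDi S (j + 1) u) (tDi S j (fun q ↦ Θ (u q, xD u q, xD (xD u) q))) (V ×ˢ S) := by
      rw [tDi_succ]
      exact tDi_congr (fun q hq ↦ hpde q hq) j
    rw [iteratedFDeriv_slice_congr hV hcongr (hsub hq.2) hq.1 m]
    exact hC q hq

end PDE

/-! ### From time jets to all space–time derivatives -/

section SpaceTime

variable {V : Set E} {S S' : Set ℝ}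

/-- **Bounds on all spatial derivatives of all time derivatives give bounds on all space–time
derivatives.** For `u` of class `C^∞` on `V × S` (`V` open, `S` of unique differentiability with
no point isolated from its interior): if for all `k, m` the spatial derivatives `D_yᵐ ∂ₜᵏ u` are
bounded over `V × S'` (`S' ⊆ S`), then every iterated derivative `Dⁿu` within `V × S` is bounded
over `V × S'`. Induction on `n`: `Dⁿ⁺¹u = Dⁿ(Du)` and `Du = ∂_y u ∘ pr₁ + pr₂ · ∂ₜu`, where
`∂_y u` and `∂ₜ u` again satisfy the hypothesis (`∂ₜᵏ∂_y = ∂_y∂ₜᵏ`). [folklore] -/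
theorem exists_norm_iteratedFDerivWithin_le (hV : IsOpen V) (hS : UniqueDiffOn ℝ S)
    (hS' : S ⊆ closure (interior S)) (hsub : S' ⊆ S) :
    ∀ (n : ℕ) {F : Type u} [NormedAddCommGroup F] [NormedSpace ℝ F] {u : E × ℝ → F}
      (_ : ContDiffOn ℝ ∞ u (V ×ˢ S))
      (_ : ∀ k m : ℕ, ∃ C : ℝ, ∀ q ∈ V ×ˢ S', ‖iteratedFDeriv ℝ m (fun y ↦ tDi S k u (y, q.2)) q.1‖ ≤ C),
      ∃ C : ℝ, ∀ q ∈ V ×ˢ S', ‖iteratedFDerivWithin ℝ n u (V ×ˢ S) q‖ ≤ C := by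
  intro n
  induction n with
  | zero =>
    intro F _ _ u hu h
    obtain ⟨C, hC⟩ := h 0 0
    refine ⟨C, fun q hq ↦ ?_⟩
    have h1 := hC q hq
    rw [norm_iteratedFDeriv_zero] at h1
    rw [norm_iteratedFDerivWithin_zero]
    simpa using h1
  | succ n ih =>
    intro F _ _ u hu h
    have hQ : UniqueDiffOn ℝ (V ×ˢ S) := hV.uniqueDiffOn.prod hS
    -- the two pieces of `Du`
    set L₁ : (E →L[ℝ] F) →L[ℝ] (E × ℝ →L[ℝ] F) :=
      ContinuousLinearMap.precomp F (ContinuousLinearMap.fst ℝ E ℝ) with hL₁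
    set L₂ : F →L[ℝ] (E × ℝ →L[ℝ] F) :=
      ContinuousLinearMap.smulRightL ℝ (E × ℝ) F (ContinuousLinearMap.snd ℝ E ℝ) with hL₂
    have hxD : ContDiffOn ℝ ∞ (xD u) (V ×ˢ S) := contDiffOn_xD hV hS hu
    have htD : ContDiffOn ℝ ∞ (tD S u) (V ×ˢ S) := contDiffOn_tD hV hS hu
    have h₁ : ContDiffOn ℝ ∞ (fun q ↦ L₁ (xD u q)) (V ×ˢ S) := L₁.contDiff.comp_contDiffOn hxD
    have h₂ : ContDiffOn ℝ ∞ (fun q ↦ L₂ (tD S u q)) (V ×ˢ S) := L₂.contDiff.comp_contDiffOn htD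
    -- the hypothesis for `∂_y u` and `∂ₜ u`
    have hbx : ∀ k m : ℕ, ∃ C : ℝ, ∀ q ∈ V ×ˢ S',
        ‖iteratedFDeriv ℝ m (fun y ↦ tDi S k (xD u) (y, q.2)) q.1‖ ≤ C := fun k m ↦
      sliceBound_tDi_xD hV hS hS' hsub hu (k := k) (fun j _ m ↦ h j m) k le_rfl m
    have hbt : ∀ k m : ℕ, ∃ C : ℝ, ∀ q ∈ V ×ˢ S',
        ‖iteratedFDeriv ℝ m (fun y ↦ tDi S k (tD S u) (y, q.2)) q.1‖ ≤ C := fun k m ↦ h (k + 1) m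
    -- the hypothesis for `L₁ ∘ ∂_y u` and `L₂ ∘ ∂ₜ u`
    have hbx' : ∀ k m : ℕ, ∃ C : ℝ, ∀ q ∈ V ×ˢ S',
        ‖iteratedFDeriv ℝ m (fun y ↦ tDi S k (fun q ↦ L₁ (xD u q)) (y, q.2)) q.1‖ ≤ C := by
      intro k m
      obtain ⟨C, hC⟩ := hbx k m
      refine ⟨‖L₁‖ * C, fun q hq ↦ ?_⟩
      rw [iteratedFDeriv_slice_congr hV (tDi_clm_comp hV hS hxD L₁ k) (hsub hq.2) hq.1 m]
      exact (norm_iteratedFDeriv_slice_clm_comp_le hV (contDiffOn_tDi hV hS hxD k) L₁ (hsub hq.2)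
        hq.1 m).trans (mul_le_mul_of_nonneg_left (hC q hq) (norm_nonneg _))
    have hbt' : ∀ k m : ℕ, ∃ C : ℝ, ∀ q ∈ V ×ˢ S',
        ‖iteratedFDeriv ℝ m (fun y ↦ tDi S k (fun q ↦ L₂ (tD S u q)) (y, q.2)) q.1‖ ≤ C := by
      intro k m
      obtain ⟨C, hC⟩ := hbt k m
      refine ⟨‖L₂‖ * C, fun q hq ↦ ?_⟩
      rw [iteratedFDeriv_slice_congr hV (tDi_clm_comp hV hS htD L₂ k) (hsub hq.2) hq.1 m]
      exact (norm_iteratedFDeriv_slice_clm_comp_le hV (contDiffOn_tDi hV hS htD k) L₂ (hsub hq.2)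
        hq.1 m).trans (mul_le_mul_of_nonneg_left (hC q hq) (norm_nonneg _))
    obtain ⟨C₁, hC₁⟩ := ih h₁ hbx'
    obtain ⟨C₂, hC₂⟩ := ih h₂ hbt'
    refine ⟨C₁ + C₂, fun q hq ↦ ?_⟩
    have hqS : q ∈ V ×ˢ S := ⟨hq.1, hsub hq.2⟩
    rw [← norm_iteratedFDerivWithin_fderivWithin hQ hqS]
    -- `Du = L₁ ∘ ∂_y u + L₂ ∘ ∂ₜ u` on `V × S`
    have hDu : EqOn (fderivWithin ℝ u (V ×ˢ S)) ((fun q ↦ L₁ (xD u q)) + fun q ↦ L₂ (tD S u q))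
        (V ×ˢ S) := by
      intro p hp
      rw [fderivWithin_eq_xD_add_tD hV hS (hu.differentiableOn (by simp)) hp, Pi.add_apply, hL₁, hL₂,
        ContinuousLinearMap.precomp_apply]
      rfl
    rw [iteratedFDerivWithin_congr hDu hqS n,
      iteratedFDerivWithin_add_apply ((h₁ q hqS).of_le (by exact_mod_cast le_top))
        ((h₂ q hqS).of_le (by exact_mod_cast le_top)) hQ hqS]
    exact (norm_add_le _ _).trans (add_le_add (hC₁ q hq) (hC₂ q hq))

/-- **All space–time derivatives of a smooth solution with bounded spatial derivatives are
bounded** (within the domain `V × S`). Combination of `sliceBound_tDi_of_pde` and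
`exists_norm_iteratedFDerivWithin_le`. [cite: Topping2006, §5.3, p. 47] -/
theorem exists_norm_iteratedFDerivWithin_le_of_pde [FiniteDimensional ℝ E] [FiniteDimensional ℝ F]
    (hV : IsOpen V) (hS : UniqueDiffOn ℝ S) (hS' : S ⊆ closure (interior S)) (hsub : S' ⊆ S)
    {Θ : F × (E →L[ℝ] F) × (E →L[ℝ] E →L[ℝ] F) → F}
    {O : Set (F × (E →L[ℝ] F) × (E →L[ℝ] E →L[ℝ] F))} (hO : IsOpen O) (hΘ : ContDiffOn ℝ ∞ Θ O)
    {K : Set (F × (E →L[ℝ] F) × (E →L[ℝ] E →L[ℝ] F))} (hK : IsCompact K) (hKO : K ⊆ O)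
    {u : E × ℝ → F} (hu : ContDiffOn ℝ ∞ u (V ×ˢ S))
    (huO : MapsTo (fun q ↦ (u q, xD u q, xD (xD u) q)) (V ×ˢ S) O)
    (huK : MapsTo (fun q ↦ (u q, xD u q, xD (xD u) q)) (V ×ˢ S') K)
    (hpde : ∀ q ∈ V ×ˢ S, tD S u q = Θ (u q, xD u q, xD (xD u) q))
    (hb : ∀ m : ℕ, ∃ C : ℝ, ∀ q ∈ V ×ˢ S', ‖iteratedFDeriv ℝ m (fun y ↦ u (y, q.2)) q.1‖ ≤ C)
    (n : ℕ) : ∃ C : ℝ, ∀ q ∈ V ×ˢ S', ‖iteratedFDerivWithin ℝ n u (V ×ˢ S) q‖ ≤ C :=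
  exists_norm_iteratedFDerivWithin_le hV hS hS' hsub n hu
    (sliceBound_tDi_of_pde hV hS hS' hsub hO hΘ hK hKO hu huO huK hpde hb)

/-- **The form consumed by the extension lemma.** Under the hypotheses of
`exists_norm_iteratedFDerivWithin_le_of_pde`, on every `V × S₀` with `S₀ ⊆ S'` OPEN the
unrestricted iterated derivatives `Dⁿu` are bounded (there `V × S₀` is open, so the derivatives
within `V × S` are the unrestricted ones) — hypothesis `hb` of
`Literature.Analysis.Calculus.exists_contDiffOn_closure_of_bounded_iteratedFDeriv` and of
`exists_contDiffOn_slab_extension`. [cite: Topping2006, §5.3, p. 47] -/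
theorem exists_norm_iteratedFDeriv_le_of_pde [FiniteDimensional ℝ E] [FiniteDimensional ℝ F]
    (hV : IsOpen V) (hS : UniqueDiffOn ℝ S) (hS' : S ⊆ closure (interior S)) (hsub : S' ⊆ S)
    {S₀ : Set ℝ} (hS₀ : IsOpen S₀) (hS₀' : S₀ ⊆ S')
    {Θ : F × (E →L[ℝ] F) × (E →L[ℝ] E →L[ℝ] F) → F}
    {O : Set (F × (E →L[ℝ] F) × (E →L[ℝ] E →L[ℝ] F))} (hO : IsOpen O) (hΘ : ContDiffOn ℝ ∞ Θ O)
    {K : Set (F × (E →L[ℝ] F) × (E →L[ℝ] E →L[ℝ] F))} (hK : IsCompact K) (hKO : K ⊆ O)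
    {u : E × ℝ → F} (hu : ContDiffOn ℝ ∞ u (V ×ˢ S))
    (huO : MapsTo (fun q ↦ (u q, xD u q, xD (xD u) q)) (V ×ˢ S) O)
    (huK : MapsTo (fun q ↦ (u q, xD u q, xD (xD u) q)) (V ×ˢ S') K)
    (hpde : ∀ q ∈ V ×ˢ S, tD S u q = Θ (u q, xD u q, xD (xD u) q))
    (hb : ∀ m : ℕ, ∃ C : ℝ, ∀ q ∈ V ×ˢ S', ‖iteratedFDeriv ℝ m (fun y ↦ u (y, q.2)) q.1‖ ≤ C)
    (n : ℕ) : ∃ C : ℝ, ∀ q ∈ V ×ˢ S₀, ‖iteratedFDeriv ℝ n u q‖ ≤ C := by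
  obtain ⟨C, hC⟩ := exists_norm_iteratedFDerivWithin_le_of_pde hV hS hS' hsub hO hΘ hK hKO hu huO
    huK hpde hb n
  refine ⟨C, fun q hq ↦ ?_⟩
  have hq' : q ∈ V ×ˢ S' := ⟨hq.1, hS₀' hq.2⟩
  have hqS : q ∈ V ×ˢ S := ⟨hq.1, hsub (hS₀' hq.2)⟩
  have hopen : IsOpen (V ×ˢ S₀) := hV.prod hS₀
  have hmem : V ×ˢ S ∈ 𝓝 q :=
    Filter.mem_of_superset (hopen.mem_nhds hq) (Set.prod_mono Subset.rfl (hS₀'.trans hsub))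
  have hn : ((n : ℕ∞) : WithTop ℕ∞) ≤ ∞ := by exact_mod_cast le_top
  have hat : ContDiffAt ℝ n u q := (hu.of_le hn).contDiffAt hmem
  rw [← iteratedFDerivWithin_eq_iteratedFDeriv (hV.uniqueDiffOn.prod hS) hat hqS]
  exact hC q hq'

end SpaceTime

end TimeJetBounds

end Literature.Analysis.Calculus

end
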